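import Mathlib
import HarnessLib
import HarnessLib.Audit
import Summits.FinalStateConjecture.Statement
import Literature.Geometry.Lorentzian.QuasiFinalStateDecomposition
import Literature.Geometry.Lorentzian.InitialDataHomothety
import HarnessLib.Audit.Status.Attr

/-!
Route: RootDecompCensoredShadow

# Route RootDecompCensoredShadow — Root decomposition N5c «CensoredShadow» (flat form a) — tame
censorship ∧ censored gross capture ∧ shadow junction ∧ mesoscopic ringdown ∧ ringdown junction ∧
perturbative cell (N5 residual carved)

DECOMPOSITION CELL decomp-fsc (D-0178; doctrine D-0170/0171/0172), summit S =
`_root_.FinalStateConjecture` exactly as typed; LADDER rung 0 — NOTHING IN THIS FILE PROVES THE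
FINAL STATE CONJECTURE. OR-SIBLING REFINEMENT of the cell's file of record
Theses/RootDecompCaptureCells.lean (route-FinalStateConjecture-RootDecompCaptureCells, node N5,
whose crux WildCell stmt-24308 carries the filed gen-1 split 25325 ∧ 25326 ∧ 25327): this file =
node N5b «ShadowCensorship» = lens decomp-fsc-lens-6 gen 3 «ShadowCensorshipCarve», CLEARED by the
critic decomp-fsc-crit-1-g0 (verdict line on HOME/STATUS.md, quoted in the BORN line), filed as a
THIN SIBLING ROUTE under the critic's standing rule 03:00:14Z (gen-3 cuts of a gen-2 child:
parent-route items BY SIGNATURE, every cut once, the cut parent stays on its route as an internal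
node). FILING FORM (a) = the flat cone, used per the critic's RULING 03:45:22Z («file (a) AT ONCE if
(b) bounces for any gate-mechanical reason»): form (b) was born as
route-FinalStateConjecture-RootDecompShadowCensorship (rev 0 61d1d5d1670a, top level BY SIGNATURE
only: 25325/25326/25327/24307) but its glued split of GenericCoarseCapture bounced three times on
the by-signature child TameCensorship = stmt-17269 («signature does not elaborate standalone in the
context of Summits/…/Theorems/ChannelsResolveTameDevelopmentsR/Negative/TameChartsBoostBlind.lean» —
a gate-side context attached to the existing item, not a property of the text, which is byte-equal
to 17269 and attaches fine at route open); that by-signature-only sibling is to be superseded by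
this route. DOMINATION POINTER for provers served A = stmt-25325 GenericCoarseCapture: «A ⟺
TameCensorship ∧ CensoredGrossCapture ∧ CensorshipShadowJunction (kernel
`genericCoarseCapture_iff_pieces`, HOME/decomp-fsc-lens-6/g3/ShadowCensorshipCarve.lean @beb065f9);
attack CensoredGrossCapture here (and WeakCosmicCensorshipTame = stmt-17269 on its own routes), not
A». The whole AND/OR tree is kept in HOME/TREE.md (HOME = run/shared/lean/pub/decomp-fsc). Writer
checks: the four by-signature statements are byte-EQUAL to the ledger signatures of stmt-17269 /
25326 / 25327 / 24307; the two new pieces carry 25325's lets verbatim (common prefix 2042/2174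
chars, then the new `let Censored`); native glue check OK (lens filing/native.out and my re-run).
It suffices to show six things, and the split is exact (FinalStateConjecture ⟺ A₁ ∧ A₂ ∧ A₃ ∧ M ∧ J
∧ PC, kernel `summit_iff_six` in the
cell file HOME/decomp-fsc-lens-6/g3/ShadowCensorshipCarve.lean; `genericCoarseCapture_iff_split` in
g3/SplitCheck.lean against the tree decl):
(A₁) TameCensorship — verbatim the registered item stmt-FinalStateConjecture-17269 (tame weak cosmic
censorship, cited by signature);
(A₂) CensoredGrossCapture — among CENSORED admissible data the UNIT SHADOW Q_Σ of the summit
property (every MGHD is unit-captured: a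
sub-extremal 1-quasi final state decomposition in the Statement's C² chart currency with every rider
kept) is reached along a tame line
from every datum failing it; (A₃) CensorshipShadowJunction — at naked data a censorship-exit line
yields a shadow-exit line (the ∧-toll);
(M) MesoscopicRingdown — verbatim stmt-FinalStateConjecture-25326; (J) RingdownJunction — verbatim
stmt-FinalStateConjecture-25327;
(PC) PerturbativeCell — verbatim stmt-FinalStateConjecture-24307. This is the ALTERNATIVE
DECOMPOSITION (D-0019: a separate thin route
sharing decls) of the born node GenericCoarseCapture (stmt-FinalStateConjecture-25325) of
route-FinalStateConjecture-RootDecompCaptureCells: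
GenericCoarseCapture ⟺ A₁ ∧ A₂ ∧ A₃; every other item of the parent route's cone is attached BY
SIGNATURE (25326, 25327, 24307), every cut once.
Cell decomp-fsc, lens 6 «barrier-complement carving», generation 3.
Lean:
`Summit.FinalStateConjecture.FinalStateConjecture.Theses.RootDecompCensoredShadow.TameCensorship ∧
Summit.FinalStateConjecture.FinalStateConjecture.Theses.RootDecompCensoredShadow.CensoredGrossCapture
∧
Summit.FinalStateConjecture.FinalStateConjecture.Theses.RootDecompCensoredShadow.CensorshipShadowJunction
∧
Summit.FinalStateConjecture.FinalStateConjecture.Theses.RootDecompCensoredShadow.MesoscopicRingdown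
∧ Summit.FinalStateConjecture.FinalStateConjecture.Theses.RootDecompCensoredShadow.RingdownJunction
∧ Summit.FinalStateConjecture.FinalStateConjecture.Theses.RootDecompCensoredShadow.PerturbativeCell`

## Assembly
Pure logic over the Statement's own shape (`IsTameChristodoulouGeneric` unfolds to «every admissible
exceptional datum is left by a tame
immersed injective admissible line whose members c ≠ 0 are good»): given an admissible
P_Σ-exceptional datum d, excluded middle on
«d is captured» — PerturbativeCell cures the captured case; otherwise excluded middle on «Q_Σ d» —
MesoscopicRingdown cures the shadowed
case; otherwise a Q-exit through d (CensoredGrossCapture if d is censored; if d is naked,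
TameCensorship's censorship exit handed to
CensorshipShadowJunction) is turned into a P-exit by RingdownJunction. Deciding theorem `closes` in
glue.lean (6 binders, all used;
= `closes_root` of g3/SplitCheck.lean through the born `RootDecompCaptureCells.closes`).

Rationale: WHY THIS LINE. The gen-2 residual GenericCoarseCapture («the unit shadow Q_Σ is tame-generic») lies
outside the technique class of all nine late-time
barrier families of Literature/Barriers/FinalStateConjecture, and exactly one catalogued family
still touches it: NakedSingularityInstability,
because censorship is a conjunct of Q_Σ. The RELATIVE GENERICITY DOOR (Christodoulou1999 p. A24;
tree
`InitialDataSet.isTameChristodoulouGeneric_of_relative_exceptional`: a generic hypothesis enters a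
generic conclusion along its curves,
never by conjunction — tree negative `isTameChristodoulouGeneric_and_fails`) applied at that
conjunct OF THE SHADOW carves the family out:
A ⟺ A₁ ∧ A₂ ∧ A₃ with A₁ = 17269 by name, A₂ the first item of the decomposition cell on which NO
catalogued barrier family and no
registered hard core bears (17308 GenericCensoredCapture contains 17269 and concerns the C⁰ → C²
upgrade; 10745 EternalStationaryExteriorIsKerr
concerns stationary exteriors, which are Q-good when unit-close to Kerr), and A₃ the honest ∧-toll
charged only at naked data. Both new items
are strictly below every existing censorship-cut item on both axes (population ¬Q ∧ Censored resp.
¬Censored, cure Q instead of P: kernel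
`censoredGrossCapture_of_eternalCell`, `nakedShadowExit_of_censorshipCell` against the asides
stmt-24310 / 24309), so the line does what
neither RootDecompGermJunction's door (cure P, junction at all bad data) nor RootDecompCaptureCells'
asides do: it isolates the GROSS
non-perturbative dynamics of censored vacuum (finite horizon census along a generic line; no eternal
unit-amplitude dynamics — only
time-periodicity is excluded in print, arXiv:1504.04592; honest exhaustive chart geometry) as one
killable item relieved of censorship,
of decay rates, of rigidity and of the third law. Nothing is imported from another area; the
negatives index (UniformPhotonSphereChannels) is unrelated.

RANKED CRUXES. #2 CensoredGrossCapture (crux) — for every admissible carrier Σ and every admissible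
datum d that is CENSORED (an MGHD exists and every MGHD has complete 𝓘⁺) but fails the unit shadow
Q_Σ (Q_Σ D: an MGHD exists and every MGHD has complete 𝓘⁺ and carries a 1-quasi final state
decomposition of regularity 2 on some exterior O with sub-extremal reference holes, O = exteriorOf
of the charts, rays staying in closure O, honest growing radii with eventual unit C²-closeness on
truncated slabs and causal exhaustion by certified slabs, orthochronous future-oriented hole charts
and a future-oriented flat chart — byte-identical to the let Q of stmt-FinalStateConjecture-25325),
there are one end e and a tame (IsTameDataFamily e 1) immersed-at-0 injective family F of admissible
data with F 0 = d all of whose members c ≠ 0 satisfy Q_Σ. New residual of the lens-6 gen-3 cut;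
strictly below stmt-25325 and below the aside EternalCell stmt-24310. [difficulty: open-problem]
(why it might fail: gross capture can fail robustly among CENSORED data: a tame-open set whose MGHDs
fragment into ever more holes (N → ∞), keep order-unity eternal dynamics (perpetual binaries,
breathers, horizons drifting to extremality at unit C² scale) or admit no honest exhaustive
Kerr-modelled chart geometry) [Klainerman2025, arXiv:1504.04592, arXiv:0902.1173, Christodoulou1999,
DafermosLuk2017]
#3 TameCensorship (crux) — verbatim the registered hard-core item stmt-FinalStateConjecture-17269
(PhaseMixingCapture.WeakCosmicCensorshipTame, cited by signature; dedup-attach): for every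
admissible Σ, «an MGHD exists and every MGHD has complete future null infinity» is
tame-Christodoulou-generic of codimension ≥ 1 in admissibleVacuumData Σ. [difficulty: open-problem]
(why it might fail: weak cosmic censorship in the smooth tame vacuum class is open: Christodoulou's
instability theorem is BV scalar-field and does not descend (barrier Part 6); wDist-stable
naked-singularity formation from admissible vacuum data (beyond the fine-tuned examples of
arXiv:2204.09891) is not excluded) [Christodoulou1999, arXiv:2204.09891, arXiv:2402.00062,
arXiv:0811.0354, arXiv:1912.08478]
#4 CensorshipShadowJunction (crux) — the ∧-toll of the censorship door applied to the unit shadow,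
charged only at NAKED data: for every admissible Σ and every admissible datum d that is not
censored, a tame immersed injective one-ended family of admissible data through d whose members c ≠
0 are censored yields a tame immersed injective one-ended family of admissible data through d whose
members c ≠ 0 satisfy Q_Σ (possibly another family, another end). Vacuous under the parent; its
typed sufficient condition is TameExitTrim ∧ ShadowGeneralPosition (lens kernel
`censorshipShadowJunction_of_generalPosition`, asides, not items). [deps: TameCensorship,
CensoredGrossCapture] [difficulty: L] (why it might fail: tame genericity is not ∧-closed (tree
negative isTameChristodoulouGeneric_and_fails): along the censorship-exit line through a naked datum
the censored-but-not-unit-captured data may accumulate at the base parameter (a Cantor-like bad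
set), and no other line need be available) [Christodoulou1999, arXiv:0811.0354, Klainerman2025]
#5 MesoscopicRingdown (crux) — verbatim the born item stmt-FinalStateConjecture-25326
(RootDecompCaptureCells.MesoscopicRingdown, cited by signature; dedup-attach): for every Σ and every
admissible P_Σ-exceptional datum d inside the unit shadow (Q_Σ d) that is not captured (at some
tolerance δ > 0 never eventually δ-captured), a tame exit with cure P_Σ — the mesoscopic ringdown
gap between unit capture and capture at every tolerance. [difficulty: open-problem] (why it might
fail: an eternally breathing remnant of Kerr–Schild amplitude below 1 but bounded away from 0
(nonlinear bound state / limit cycle) persisting on a tame-open set would be unit-captured, never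
captured at small tolerance, and incurable.) [arXiv:2104.11857, arXiv:2205.14808, Klainerman2025,
arXiv:1606.04014]
#6 RingdownJunction (crux) — verbatim the born item stmt-FinalStateConjecture-25327
(RootDecompCaptureCells.RingdownJunction, cited by signature; dedup-attach): for every Σ and every
admissible P_Σ-exceptional datum d outside the unit shadow (¬ Q_Σ d), a tame exit with cure Q_Σ
yields a tame exit with cure P_Σ. [deps: CensoredGrossCapture, CensorshipShadowJunction,
TameCensorship] [difficulty: L] (why it might fail: a Cantor-like set of P-bad parameters
accumulating at 0 along every Q-exit line through some Q-exceptional datum (laminated ringdown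
failure inside the unit shadow) gives a Q-exit with no P-exit.) [Christodoulou1999,
arXiv:gr-qc/0702084, Klainerman2025]
#7 PerturbativeCell (crux) — verbatim the born item stmt-FinalStateConjecture-24307
(RootDecompCaptureCells.PerturbativeCell, cited by signature; dedup-attach): for every Σ and every
admissible P_Σ-exceptional datum d that IS captured (censored and δ-captured at every tolerance δ >
0), a tame exit with cure P_Σ — the generic third law plus gauge stitching. [difficulty:
open-problem] (why it might fail: data whose MGHDs converge to an EXACTLY EXTREMAL Kerr exterior
might fill a tame-open set (third law false in the charged model, arXiv:2211.15742; extremal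
formation conjectured critical = positive codimension, arXiv:2402.10190, unproved in vacuum).)
[Klainerman2025, arXiv:2211.15742, arXiv:2402.10190, KlainermanSzeftel2020, Hintz2026]

TWO-LAYER PLAN. Foreseen (not filed): CensoredGrossCapture ⇐ BoundedCensusGross →
UnboundedCensusExit → CensusJunction → CensoredGrossCapture, the free
population split of the censored-but-unshadowed cell by the datum's own HORIZON CENSUS fate
(finitely many holes forever vs N → ∞
fragmentation; Literature BlackHoleCensus vocabulary), k = 3, depth 1.

KILL CRITERIA. A refutation of CensoredGrossCapture (a tame-open set of censored admissible data
with no Q-good tame line — e.g. a wDist-stable eternal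
unit-amplitude censored configuration) closes the route outright (`--reason
refuted:CensoredGrossCapture`) and refutes the summit with it
(every item is S-implied: kernel `pieces_of_summit`). A refutation of CensorshipShadowJunction
forces a pivot to the merged cell form
NakedShadowExit (= TameCensorship ∧ CensorshipShadowJunction, kernel `nakedShadowExit_iff`) as one
item. A proof of GenericCoarseCapture
(stmt-25325) on the parent route moots A₁–A₃ here; a proof of WildCell (stmt-24308) moots everything
but PerturbativeCell.

NOT DECOMPOSED YET. The census / stationarity sub-structure of CensoredGrossCapture (bounded vs
unbounded horizon census; eventually stationary at unit scale vs
not) and the PDE-free support TameExitTrim (re-basing a punctured-neighbourhood cure; provable now,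
to be attached with `--supports
CensorshipShadowJunction`) are deliberately not items at open: layer-2 children / prover-level
supports later (D-0019).

CHEAPEST FALSIFIER. Membership census for CensoredGrossCapture: is there ANY known censored vacuum
evolution (numerical or exact) whose exterior never becomes
unit-C²-close to a sub-extremal Kerr–Schild chart system on exhaustive slabs — a perpetual binary, a
large breather, an N → ∞ cascade? In
print only genuinely time-periodic vacuum is excluded near 𝓘 (arXiv:1504.04592); no example is known
(lookup run 2026-08-30: corpus hybrid
+ galaxy, no hits). In Lean: the crux probes `#h21_crux_probe` on both new items are CLEAN
(g3/bc/bc7.txt) and no child or pair of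
children gives the parent by `exact? | aesop | tauto` (g3/bc/parent-probe.txt).

NUMBERS. Unit tolerance δ = 1 and regularity k = 2 in the shadow Q_Σ are the Statement's own
currency one dial-stop down (truncDeviationCk ≤ 1 on
truncated slabs of honest radius R ≥ max(r₊, 0) + 1); sub-extremality |a| < M of the REFERENCE
charts (Kerr.IsSubextremal); codimension 1,
tameness order 1 as in the Statement.

DEFINITION REQUESTS. None: every notion is in the tree (QuasiFinalStateDecomposition,
IsTameChristodoulouGeneric, exteriorOf, RaysStayInClosure, certifiedLate/Slab).

Novelty: Searches (2026-08-30): lit search --hybrid "no time-periodic asymptotically flat vacuum spacetimes"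
(6 docs; arXiv:1504.04592 p.9, Hawking–Ellis pp.376–377); lit search --hybrid "bound on the number
of black holes formed in gravitational collapse vacuum" (6 textbook docs, no bound); lit vsearch
"complete null infinity but the exterior never settles: eternal binary or breather vacuum solutions"
(6 docs, none on point); lit search --hybrid "final state conjecture finitely many Kerr black holes
moving apart generic" (6 docs: Klainerman–Szeftel 2020 pp.100–101, Daudé 2017); lit galaxy search
"time-periodic vacuum|helically symmetric|no periodic solutions" --star all (16 rows, none
relevant); lit galaxy search "naked singularities for the Einstein vacuum|weak cosmic censorship in
vacuum" --star all (0 rows); earlier this cell: Klainerman 2025 CR Mécanique §2.3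
[corpus:paper:doi-10-5802-crmeca-290 p.6].
Nearest prior art found: Christodoulou1999 (CQG 16 A23, p. A24: the genericity formulation and the
relative door, scalar-field model); arXiv:1504.04592 (Alexakis–Schlue: no genuinely time-periodic AF
vacuum near 𝓘 — the only printed no-go toward «no eternal censored dynamics»); Klainerman2025 §2.3
(orbital vs asymptotic stability as notions; no data-side generic statement); in the tree:
RootDecompGermJunction (door at censorship, cure P) and RootDecompCaptureCells asides 24309/24310
(population cut by censorship, cure P).
Delta: the censorship door is applied to the UNIT SHADOW rath  [refs: 1504.04592, paper:doi-10-5802-crmeca-290, Christodoulou1999, Klainerman2025]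

Barriers (technique_class: genericity-door, barrier-complement, coarse-capture): - technique_class: genericity-door, barrier-complement, coarse-capture
- Literature.Barriers.FinalStateConjecture.nakedSingularityInstability: TameCensorship sits INSIDE
and honours it (Part 6 nakedSingularityInstabilityNarrow records the smooth-class generic statement
as open; no descent from the BV scalar-field theorem is claimed); CensoredGrossCapture is OUTSIDE by
construction (base datum and line members censored — censorship consumed, never produced);
CensorshipShadowJunction takes TameCensorship's line as input and claims no instability mechanism.
- Literature.Barriers.FinalStateConjecture.AretakisInstability: outside — sub-extremal REFERENCE
charts capture extremal and near-extremal true horizons at unit tolerance (Kerr–Schild is smooth in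
a through a = M); the extremal threshold is PerturbativeCell's content (third law), cited by
signature, not attacked here.
- Literature.Barriers.FinalStateConjecture.KerrLinearHair: outside — no decay or mode statement;
unit closeness on truncated slabs only.
- Literature.Barriers.FinalStateConjecture.KerrSuperradiance: outside — no frequency-uniform
estimate is claimed; labels are free on the whole sub-extremal range.
- Literature.Barriers.FinalStateConjecture.PriceLawTail: outside — no rate; eventual unit closeness
only.
- Literature.Barriers.FinalStateConjecture.SbierskiTrappingObstruction: outside — no high-frequency
/ derivative-loss estimate is part of any new item; MesoscopicRingdown (by signature) is where it
lives.
- Litera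

sub-problem: FinalStateConjecture · status: draft · opened planner-decomp-fsc-writer-1-g0-0 2026-08-30T03:53:43Z · rev 1 · ledger route-FinalStateConjecture-RootDecompCensoredShadow
GENERATED by the gate from the ledger (D-0016/17). Provers cite these decls: `theorem foo : Summit.FinalStateConjecture.FinalStateConjecture.Theses.RootDecompCensoredShadow.<Decl> := …` in Summits/FinalStateConjecture/FinalStateConjecture/Theorems/<Name>.lean.
-/

namespace Summit.FinalStateConjecture.FinalStateConjecture.Theses.RootDecompCensoredShadow

open scoped BigOperators Topology Manifold Classical MeasureTheory ProbabilityTheory Matrix InnerProductSpace ComplexConjugate ContinuousMap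
open Filter Set Function TopologicalSpace MeasureTheory

attribute [summit_statement] _root_.FinalStateConjecture

/-- item stmt-FinalStateConjecture-27102 · crux · rank 2 · SPLIT (gen 1) into CoreGrossCapture, ScaleJunction, BoundedRoughnessCapture + glue CensoredGrossCaptureGlue · direct attempts still welcome (low priority) · by planner
why it might fail: gross capture can fail robustly among CENSORED data: a tame-open set whose MGHDs fragment into ever more holes (N → ∞), keep order-unity eternal dynamics (perpetual binaries, breathers, horizons drifting to extremality at unit C² scale) or admit no honest exhaustive Kerr-modelled chart geometry
sources: Klainerman2025, arXiv:1504.04592, arXiv:0902.1173, Christodoulou1999, DafermosLuk2017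
[crux] for every admissible carrier Σ and every admissible datum d that is CENSORED (an MGHD exists
and every MGHD has complete 𝓘⁺) but fails the unit shadow Q_Σ (Q_Σ D: an MGHD exists and every MGHD
has complete 𝓘⁺ and carries a 1-quasi final state decomposition of regularity 2 on some exterior O
with sub-extremal reference holes, O = exteriorOf of the charts, rays staying in closure O, honest
growing radii with eventual unit C²-closeness on truncated slabs and causal exhaustion by certified
slabs, orthochronous future-oriented hole charts and a future-oriented flat chart — byte-identical
to the let Q of stmt-FinalStateConjecture-25325), there are one end e and a tame (IsTameDataFamily e
1) immersed-at-0 injective family F of admissible data with F 0 = d all of whose members c ≠ 0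
satisfy Q_Σ. New residual of the lens-6 gen-3 cut; strictly below stmt-25325 and below the aside
EternalCell stmt-24310. [difficulty: open-problem] -/
@[route_item "route-FinalStateConjecture-RootDecompCensoredShadow", crux]
def CensoredGrossCapture : Prop :=
  ∀ (X : Type) [TopologicalSpace X] [ChartedSpace Literature.Geometry.Lorentzian.E3 X] [IsManifold (𝓡 3) ((⊤ : ℕ∞) : WithTop ℕ∞) X] [T2Space X] [SecondCountableTopology X] [ConnectedSpace X], let Q : Literature.Geometry.Lorentzian.InitialDataSet (𝓡 3) X → Prop := fun D ↦ (∃ 𝒟 : Literature.Geometry.Lorentzian.VacuumCauchyDevelopment D, 𝒟.IsMaximal) ∧ ∀ 𝒟 : Literature.Geometry.Lorentzian.VacuumCauchyDevelopment D, 𝒟.IsMaximal → Summit.FinalStateConjecture.HasCompleteNullInfinity 𝒟.toCauchyDevelopment ∧ ∃ (O : Set 𝒟.carrier) (q : Literature.Geometry.Lorentzian.QuasiFinalStateDecomposition 𝒟.toSpacetime O 2 1), (∀ i, Literature.Geometry.Lorentzian.Kerr.IsSubextremal (q.mass i) (q.spin i)) ∧ O = Summit.FinalStateConjecture.exteriorOf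 𝒟.toCauchyDevelopment q.charted ∧ Summit.FinalStateConjecture.RaysStayInClosure 𝒟.toCauchyDevelopment O ∧ (∃ R : Fin q.N → ℝ → ℝ, (∀ i, Tendsto (R i) atTop atTop ∧ ∀ τ, max (Literature.Geometry.Lorentzian.Kerr.rPlus (q.mass i) (q.spin i)) 0 + 1 ≤ R i τ) ∧ (∀ i, ∀ᶠ τ in atTop, 𝒟.toSpacetime.truncDeviationCk (q.background i) (q.chart i) 2 (R i τ) τ ≤ 1) ∧ ∀ τ₁ : ℝ, q.τ₀ < τ₁ → O \ q.certifiedLate R τ₁ ⊆ 𝒟.toSpacetime.metric.causalPast 𝒟.toSpacetime.timeOrientation (q.certifiedSlab R τ₁)) ∧ ((∀ i, Summit.FinalStateConjecture.IsOrthochronous (q.motion i).1) ∧ (∀ i (ρ : ℝ), ∀ᶠ τ in atTop, ∀ x ∈ (q.background i).truncTimeSlab ρ τ, 𝒟.toSpacetime.timeOrientation.IsFutureDirected (mfderiv 𝓘(ℝ, Literature.Geometry.Lorentzian.E4) (𝓡 4) (q.chart i) x (((q.motion i).1 : Literature.Geometry.Lorentzian.E4 ≃L[ℝ] Literature.Geometry.Lorentzian.E4)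 (Literature.Geometry.Lorentzian.Kerr.timeVector (q.mass i) (q.spin i) (Literature.Geometry.Lorentzian.poincareInv (q.motion i).1 (q.motion i).2 (x : Literature.Geometry.Lorentzian.E4)))))) ∧ ∀ᶠ τ in atTop, ∀ x ∈ (Literature.Geometry.Lorentzian.Minkowski.backgroundOn q.flatDomain).timeSlab τ, 𝒟.toSpacetime.timeOrientation.IsFutureDirected (mfderiv 𝓘(ℝ, Literature.Geometry.Lorentzian.E4) (𝓡 4) q.flatChart x (Literature.Geometry.Lorentzian.E4.basisVector 0))); let Censored : Literature.Geometry.Lorentzian.InitialDataSet (𝓡 3) X → Prop := fun D ↦ (∃ 𝒟 : Literature.Geometry.Lorentzian.VacuumCauchyDevelopment D, 𝒟.IsMaximal) ∧ ∀ 𝒟 : Literature.Geometry.Lorentzian.VacuumCauchyDevelopment D, 𝒟.IsMaximal → Summit.FinalStateConjecture.HasCompleteNullInfinity 𝒟.toCauchyDevelopment; ∀ d ∈ Literature.Geometry.Lorentzian.admissibleVacuumData X, ¬ Q d → Censored d → ∃ (e : Literature.Geometry.Lorentzian.AFEnd X) (F : EuclideanSpace ℝ (Fin 1) → Literature.Geometry.Lorentzian.InitialDataSet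 (𝓡 3) X), Literature.Geometry.Lorentzian.InitialDataSet.IsTameDataFamily e 1 F ∧ Literature.Geometry.Lorentzian.InitialDataSet.IsImmersedAtZero 1 F ∧ F 0 = d ∧ Injective F ∧ (∀ c, F c ∈ Literature.Geometry.Lorentzian.admissibleVacuumData X) ∧ ∀ c ≠ 0, Q (F c)

-- parent: CensoredGrossCapture · child (gen 1)
/--     item stmt-FinalStateConjecture-27470 · crux · rank 201 · open
    parent: CensoredGrossCapture · by planner
    why it might fail: scale-free gross capture can fail robustly among censored data: a tame-open set whose MGHDs fragment without end (N → ∞), carry eternal unit-amplitude dynamics (bounded binaries, breathers) or unbounded C¹/C² horizon hair (Aretakis-type growth on horizons drifting to extremality)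
    sources: Klainerman2025, arXiv:1206.6598, arXiv:1504.04592, Christodoulou1999, DafermosLuk2017
[crux · gen-4 cut of CensoredGrossCapture (stmt-FinalStateConjecture-27102), lens-6 g4 node
ScaleCarve; NEW RESIDUAL · WEAKER (lens kernel coreGrossCapture_of_censoredGrossCapture; ⇏ parent:
silent on censored data unit-captured at some scale but not their own) · DILATION-INVARIANT
population and cure (kernel scaleCaptured_homothety_iff, coreGrossExitAt_homothety modulo the
PDE-free covariance items) — a statement on the scale-free moduli admissibleVacuumData Σ / ℝ₊ ·
OUTSIDE all 13 catalogued barrier families of Literature/Barriers/FinalStateConjecture without the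
fixed-tolerance caveat (no scale fixed ⇒ no derivative precision asked at any scale) · leaf
IDEA-NEEDED (censored developments unit-captured at NO scale: infinite fragmentation, eternal
bounded binaries / breathers of unit gross amplitude, unit-far eternal geometry, dishonest causal
chart geometry, UNBOUNDED derivative growth = horizon hair) · INSTRUMENTABLE (membership)] For every
Σ, every admissible censored datum NO homothetic copy (c²h, ck), c > 0, of which satisfies the unit
shadow Q_Σ (the born let Q of stmt-25325/27102) lies on a tame immersed injective one-ended line of
admissible data each of whose members c ≠ 0 -/
@[route_item "route-FinalStateConjecture-RootDecompCensoredShadow"]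
def CoreGrossCapture : Prop :=
  ∀ (X : Type) [TopologicalSpace X] [ChartedSpace Literature.Geometry.Lorentzian.E3 X] [IsManifold (𝓡 3) ((⊤ : ℕ∞) : WithTop ℕ∞) X] [T2Space X] [SecondCountableTopology X] [ConnectedSpace X], let Q : Literature.Geometry.Lorentzian.InitialDataSet (𝓡 3) X → Prop := fun D ↦ (∃ 𝒟 : Literature.Geometry.Lorentzian.VacuumCauchyDevelopment D, 𝒟.IsMaximal) ∧ ∀ 𝒟 : Literature.Geometry.Lorentzian.VacuumCauchyDevelopment D, 𝒟.IsMaximal → Summit.FinalStateConjecture.HasCompleteNullInfinity 𝒟.toCauchyDevelopment ∧ ∃ (O : Set 𝒟.carrier) (q : Literature.Geometry.Lorentzian.QuasiFinalStateDecomposition 𝒟.toSpacetime O 2 1), (∀ i, Literature.Geometry.Lorentzian.Kerr.IsSubextremal (q.mass i) (q.spin i)) ∧ O = Summit.FinalStateConjecture.exteriorOf 𝒟.toCauchyDevelopment q.charted ∧ Summit.FinalStateConjecture.RaysStayInClosure 𝒟.toCauchyDevelopment O ∧ (∃ R : Fin q.N → ℝ → ℝ, (∀ i, Tendsto (R i)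 atTop atTop ∧ ∀ τ, max (Literature.Geometry.Lorentzian.Kerr.rPlus (q.mass i) (q.spin i)) 0 + 1 ≤ R i τ) ∧ (∀ i, ∀ᶠ τ in atTop, 𝒟.toSpacetime.truncDeviationCk (q.background i) (q.chart i) 2 (R i τ) τ ≤ 1) ∧ ∀ τ₁ : ℝ, q.τ₀ < τ₁ → O \ q.certifiedLate R τ₁ ⊆ 𝒟.toSpacetime.metric.causalPast 𝒟.toSpacetime.timeOrientation (q.certifiedSlab R τ₁)) ∧ ((∀ i, Summit.FinalStateConjecture.IsOrthochronous (q.motion i).1) ∧ (∀ i (ρ : ℝ), ∀ᶠ τ in atTop, ∀ x ∈ (q.background i).truncTimeSlab ρ τ, 𝒟.toSpacetime.timeOrientation.IsFutureDirected (mfderiv 𝓘(ℝ, Literature.Geometry.Lorentzian.E4) (𝓡 4) (q.chart i) x (((q.motion i).1 : Literature.Geometry.Lorentzian.E4 ≃L[ℝ] Literature.Geometry.Lorentzian.E4) (Literature.Geometry.Lorentzian.Kerr.timeVector (q.mass i) (q.spin i) (Literature.Geometry.Lorentzian.poincareInv (q.motion i).1 (q.motion i).2 (x : Literature.Geometry.Lorentzian.E4))))))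 ∧ ∀ᶠ τ in atTop, ∀ x ∈ (Literature.Geometry.Lorentzian.Minkowski.backgroundOn q.flatDomain).timeSlab τ, 𝒟.toSpacetime.timeOrientation.IsFutureDirected (mfderiv 𝓘(ℝ, Literature.Geometry.Lorentzian.E4) (𝓡 4) q.flatChart x (Literature.Geometry.Lorentzian.E4.basisVector 0))); let Censored : Literature.Geometry.Lorentzian.InitialDataSet (𝓡 3) X → Prop := fun D ↦ (∃ 𝒟 : Literature.Geometry.Lorentzian.VacuumCauchyDevelopment D, 𝒟.IsMaximal) ∧ ∀ 𝒟 : Literature.Geometry.Lorentzian.VacuumCauchyDevelopment D, 𝒟.IsMaximal → Summit.FinalStateConjecture.HasCompleteNullInfinity 𝒟.toCauchyDevelopment; let QS : Literature.Geometry.Lorentzian.InitialDataSet (𝓡 3) X → Prop := fun D ↦ ∃ (c : ℝ) (hc : 0 < c), Q (Literature.Geometry.Lorentzian.InitialDataSet.homothety D c hc); ∀ d ∈ Literature.Geometry.Lorentzian.admissibleVacuumData X, ¬ QS d → Censored d → ∃ (e : Literature.Geometry.Lorentzian.AFEnd X) (F : EuclideanSpace ℝ (Fin 1) → Literature.Geometry.Lorentzian.InitialDataSet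 (𝓡 3) X), Literature.Geometry.Lorentzian.InitialDataSet.IsTameDataFamily e 1 F ∧ Literature.Geometry.Lorentzian.InitialDataSet.IsImmersedAtZero 1 F ∧ F 0 = d ∧ Injective F ∧ (∀ c, F c ∈ Literature.Geometry.Lorentzian.admissibleVacuumData X) ∧ ∀ c ≠ 0, QS (F c)

-- parent: CensoredGrossCapture · child (gen 1)
/--     item stmt-FinalStateConjecture-27471 · crux · rank 202 · open
    parent: CensoredGrossCapture · by planner
    why it might fail: tame genericity is not ∧-closed (tree negative isTameChristodoulouGeneric_and_fails): along the saturated-shadow exit line the capture scales c(F s) of the members may blow up as s → 0 (roughness accumulating at the base), and no other line need be available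
    sources: Christodoulou1999, arXiv:0811.0354, BartnikIsenberg2004
[crux · thin · the ∧-tax of the scale door · WEAKER (vacuous under the parent: lens kernel
scaleJunction_of_censoredGrossCapture) · UNDECIDED — test typed in the lens kernel:
scaleJunction_of_generalPosition = TameExitTrim (PDE-free re-basing, attackable now) ∧
ScaleGeneralPosition (along every tame saturated-shadow exit line through a censored datum captured
at no scale, the members near the base are unit-captured at their OWN scale; NOT S-implied, aside)]
For every Σ, at every admissible censored datum d captured at no scale, a tame immersed injective
one-ended line of admissible data through d whose members c ≠ 0 are unit-captured at SOME scale
yields a tame immersed injective one-ended line of admissible data through d whose members c ≠ 0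
satisfy the unit shadow Q_Σ itself (possibly another line, another end). [deps: CoreGrossCapture]
[difficulty: L] [CLEARED[split] decomp-fsc-crit-1-g0 2026-08-30T04:13:06Z; caution c7
(tolerance-typing vs scale); G parked as typed, B ATTACKABLE(porting: 25326 + S1/S3/S3′/S4), J thin] -/
@[route_item "route-FinalStateConjecture-RootDecompCensoredShadow"]
def ScaleJunction : Prop :=
  ∀ (X : Type) [TopologicalSpace X] [ChartedSpace Literature.Geometry.Lorentzian.E3 X] [IsManifold (𝓡 3) ((⊤ : ℕ∞) : WithTop ℕ∞) X] [T2Space X] [SecondCountableTopology X] [ConnectedSpace X], let Q : Literature.Geometry.Lorentzian.InitialDataSet (𝓡 3) X → Prop := fun D ↦ (∃ 𝒟 : Literature.Geometry.Lorentzian.VacuumCauchyDevelopment D, 𝒟.IsMaximal) ∧ ∀ 𝒟 : Literature.Geometry.Lorentzian.VacuumCauchyDevelopment D, 𝒟.IsMaximal → Summit.FinalStateConjecture.HasCompleteNullInfinity 𝒟.toCauchyDevelopment ∧ ∃ (O : Set 𝒟.carrier) (q : Literature.Geometry.Lorentzian.QuasiFinalStateDecomposition 𝒟.toSpacetime O 2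 1), (∀ i, Literature.Geometry.Lorentzian.Kerr.IsSubextremal (q.mass i) (q.spin i)) ∧ O = Summit.FinalStateConjecture.exteriorOf 𝒟.toCauchyDevelopment q.charted ∧ Summit.FinalStateConjecture.RaysStayInClosure 𝒟.toCauchyDevelopment O ∧ (∃ R : Fin q.N → ℝ → ℝ, (∀ i, Tendsto (R i) atTop atTop ∧ ∀ τ, max (Literature.Geometry.Lorentzian.Kerr.rPlus (q.mass i) (q.spin i)) 0 + 1 ≤ R i τ) ∧ (∀ i, ∀ᶠ τ in atTop, 𝒟.toSpacetime.truncDeviationCk (q.background i) (q.chart i) 2 (R i τ) τ ≤ 1) ∧ ∀ τ₁ : ℝ, q.τ₀ < τ₁ → O \ q.certifiedLate R τ₁ ⊆ 𝒟.toSpacetime.metric.causalPast 𝒟.toSpacetime.timeOrientation (q.certifiedSlab R τ₁)) ∧ ((∀ i, Summit.FinalStateConjecture.IsOrthochronous (q.motion i).1) ∧ (∀ i (ρ : ℝ), ∀ᶠ τ in atTop, ∀ x ∈ (q.background i).truncTimeSlab ρ τ, 𝒟.toSpacetime.timeOrientation.IsFutureDirected (mfderiv 𝓘(ℝ, Literature.Geometry.Lorentzian.E4)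 (𝓡 4) (q.chart i) x (((q.motion i).1 : Literature.Geometry.Lorentzian.E4 ≃L[ℝ] Literature.Geometry.Lorentzian.E4) (Literature.Geometry.Lorentzian.Kerr.timeVector (q.mass i) (q.spin i) (Literature.Geometry.Lorentzian.poincareInv (q.motion i).1 (q.motion i).2 (x : Literature.Geometry.Lorentzian.E4)))))) ∧ ∀ᶠ τ in atTop, ∀ x ∈ (Literature.Geometry.Lorentzian.Minkowski.backgroundOn q.flatDomain).timeSlab τ, 𝒟.toSpacetime.timeOrientation.IsFutureDirected (mfderiv 𝓘(ℝ, Literature.Geometry.Lorentzian.E4) (𝓡 4) q.flatChart x (Literature.Geometry.Lorentzian.E4.basisVector 0))); let Censored : Literature.Geometry.Lorentzian.InitialDataSet (𝓡 3) X → Prop := fun D ↦ (∃ 𝒟 : Literature.Geometry.Lorentzian.VacuumCauchyDevelopment D, 𝒟.IsMaximal) ∧ ∀ 𝒟 : Literature.Geometry.Lorentzian.VacuumCauchyDevelopment D, 𝒟.IsMaximal → Summit.FinalStateConjecture.HasCompleteNullInfinity 𝒟.toCauchyDevelopment; let QS : Literature.Geometry.Lorentzian.InitialDataSet (𝓡 3)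 X → Prop := fun D ↦ ∃ (c : ℝ) (hc : 0 < c), Q (Literature.Geometry.Lorentzian.InitialDataSet.homothety D c hc); ∀ d ∈ Literature.Geometry.Lorentzian.admissibleVacuumData X, ¬ QS d → Censored d → (∃ (e : Literature.Geometry.Lorentzian.AFEnd X) (F : EuclideanSpace ℝ (Fin 1) → Literature.Geometry.Lorentzian.InitialDataSet (𝓡 3) X), Literature.Geometry.Lorentzian.InitialDataSet.IsTameDataFamily e 1 F ∧ Literature.Geometry.Lorentzian.InitialDataSet.IsImmersedAtZero 1 F ∧ F 0 = d ∧ Injective F ∧ (∀ c, F c ∈ Literature.Geometry.Lorentzian.admissibleVacuumData X) ∧ ∀ c ≠ 0, QS (F c)) → ∃ (e : Literature.Geometry.Lorentzian.AFEnd X) (F : EuclideanSpace ℝ (Fin 1) → Literature.Geometry.Lorentzian.InitialDataSet (𝓡 3) X), Literature.Geometry.Lorentzian.InitialDataSet.IsTameDataFamily e 1 F ∧ Literature.Geometry.Lorentzian.InitialDataSet.IsImmersedAtZero 1 F ∧ F 0 = d ∧ Injective F ∧ (∀ c, F c ∈ Literature.Geometry.Lorentzian.admissibleVacuumData X) ∧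 ∀ c ≠ 0, Q (F c)

-- parent: CensoredGrossCapture · child (gen 1)
/--     item stmt-FinalStateConjecture-27472 · crux · rank 203 · open
    parent: CensoredGrossCapture · by planner
    why it might fail: only via its dominator: nonlinear stability of the full sub-extremal Kerr family with polynomial tails along a tame-generic line is open beyond |a| ≪ M (Klainerman–Szeftel 2021; DHRT 2021), and the PDE-free homothety transport of tame exits (S4) must survive the weighted far-end norms
    sources: arXiv:2104.11857, arXiv:2205.14808, BartnikIsenberg2004, DafermosRodnianski2013
[crux · gen-4 cut of CensoredGrossCapture (stmt-27102) · WEAKER (lens kernel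
boundedRoughnessCapture_of_censoredGrossCapture; ⇏ parent: silent on data captured at no scale) ·
COUNTS · ATTACKABLE NOW — DOMINATED by the born sibling MesoscopicRingdown
(stmt-FinalStateConjecture-25326) through the dilation covariance of the Cauchy problem: lens kernel
boundedRoughnessCapture_of_mesoscopicRingdown : AdmissibleDilationClosed →
SummitPropDilationDescends → CapturedDilationDescends → TameExitDilation → MesoscopicRingdown →
BoundedRoughnessCapture (S1 proved in the kernel from the tree's AF-end transport; S3/S3′/S4
PDE-free typed ports of CauchyDevelopmentConstSmul / NullInfinityConstSmul / LateChartDilation /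
BoostedKerrDilation / InitialDataHomothety, M/L-sized each — the registered kill path) · INSIDE the
late-time derivative barrier families (KerrLinearHair, TrappingDerivativeLoss, PriceLawTail,
Superradiance, SlowlyRotatingOnly) exactly as stmt-25326 — this is the layer of the parent that the
unit C² tolerance δ = 1 shares with the ringdown cell once scales are sorted] For every Σ, every
admissible censored datum failing the unit shadow Q_Σ at its own scale while SOME homothetic copy -/
@[route_item "route-FinalStateConjecture-RootDecompCensoredShadow"]
def BoundedRoughnessCapture : Prop :=
  ∀ (X : Type) [TopologicalSpace X] [ChartedSpace Literature.Geometry.Lorentzian.E3 X] [IsManifold (𝓡 3) ((⊤ : ℕ∞) : WithTop ℕ∞) X] [T2Space X] [SecondCountableTopology X] [ConnectedSpace X], let Q : Literature.Geometry.Lorentzian.InitialDataSet (𝓡 3) X → Prop := fun D ↦ (∃ 𝒟 : Literature.Geometry.Lorentzian.VacuumCauchyDevelopment D, 𝒟.IsMaximal) ∧ ∀ 𝒟 : Literature.Geometry.Lorentzian.VacuumCauchyDevelopment D, 𝒟.IsMaximal → Summit.FinalStateConjecture.HasCompleteNullInfinity 𝒟.toCauchyDevelopment ∧ ∃ (O :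 Set 𝒟.carrier) (q : Literature.Geometry.Lorentzian.QuasiFinalStateDecomposition 𝒟.toSpacetime O 2 1), (∀ i, Literature.Geometry.Lorentzian.Kerr.IsSubextremal (q.mass i) (q.spin i)) ∧ O = Summit.FinalStateConjecture.exteriorOf 𝒟.toCauchyDevelopment q.charted ∧ Summit.FinalStateConjecture.RaysStayInClosure 𝒟.toCauchyDevelopment O ∧ (∃ R : Fin q.N → ℝ → ℝ, (∀ i, Tendsto (R i) atTop atTop ∧ ∀ τ, max (Literature.Geometry.Lorentzian.Kerr.rPlus (q.mass i) (q.spin i)) 0 + 1 ≤ R i τ) ∧ (∀ i, ∀ᶠ τ in atTop, 𝒟.toSpacetime.truncDeviationCk (q.background i) (q.chart i) 2 (R i τ) τ ≤ 1) ∧ ∀ τ₁ : ℝ, q.τ₀ < τ₁ → O \ q.certifiedLate R τ₁ ⊆ 𝒟.toSpacetime.metric.causalPast 𝒟.toSpacetime.timeOrientation (q.certifiedSlab R τ₁)) ∧ ((∀ i, Summit.FinalStateConjecture.IsOrthochronous (q.motion i).1) ∧ (∀ i (ρ : ℝ), ∀ᶠ τ in atTop, ∀ x ∈ (q.background i).truncTimeSlab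 ρ τ, 𝒟.toSpacetime.timeOrientation.IsFutureDirected (mfderiv 𝓘(ℝ, Literature.Geometry.Lorentzian.E4) (𝓡 4) (q.chart i) x (((q.motion i).1 : Literature.Geometry.Lorentzian.E4 ≃L[ℝ] Literature.Geometry.Lorentzian.E4) (Literature.Geometry.Lorentzian.Kerr.timeVector (q.mass i) (q.spin i) (Literature.Geometry.Lorentzian.poincareInv (q.motion i).1 (q.motion i).2 (x : Literature.Geometry.Lorentzian.E4)))))) ∧ ∀ᶠ τ in atTop, ∀ x ∈ (Literature.Geometry.Lorentzian.Minkowski.backgroundOn q.flatDomain).timeSlab τ, 𝒟.toSpacetime.timeOrientation.IsFutureDirected (mfderiv 𝓘(ℝ, Literature.Geometry.Lorentzian.E4) (𝓡 4) q.flatChart x (Literature.Geometry.Lorentzian.E4.basisVector 0))); let Censored : Literature.Geometry.Lorentzian.InitialDataSet (𝓡 3) X → Prop := fun D ↦ (∃ 𝒟 : Literature.Geometry.Lorentzian.VacuumCauchyDevelopment D, 𝒟.IsMaximal) ∧ ∀ 𝒟 : Literature.Geometry.Lorentzian.VacuumCauchyDevelopment D, 𝒟.IsMaximal → Summit.FinalStateConjecture.HasCompleteNullInfinity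 𝒟.toCauchyDevelopment; let QS : Literature.Geometry.Lorentzian.InitialDataSet (𝓡 3) X → Prop := fun D ↦ ∃ (c : ℝ) (hc : 0 < c), Q (Literature.Geometry.Lorentzian.InitialDataSet.homothety D c hc); ∀ d ∈ Literature.Geometry.Lorentzian.admissibleVacuumData X, ¬ Q d → Censored d → QS d → ∃ (e : Literature.Geometry.Lorentzian.AFEnd X) (F : EuclideanSpace ℝ (Fin 1) → Literature.Geometry.Lorentzian.InitialDataSet (𝓡 3) X), Literature.Geometry.Lorentzian.InitialDataSet.IsTameDataFamily e 1 F ∧ Literature.Geometry.Lorentzian.InitialDataSet.IsImmersedAtZero 1 F ∧ F 0 = d ∧ Injective F ∧ (∀ c, F c ∈ Literature.Geometry.Lorentzian.admissibleVacuumData X) ∧ ∀ c ≠ 0, Q (F c)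

-- parent: CensoredGrossCapture · glue (gen 1)
/--     item stmt-FinalStateConjecture-27473 · support · rank 204 · open
    parent: CensoredGrossCapture · GLUE: children ⟹ parent · by planner
CoreGrossCapture → ScaleJunction → BoundedRoughnessCapture → CensoredGrossCapture -/
@[route_item "route-FinalStateConjecture-RootDecompCensoredShadow"]
def CensoredGrossCaptureGlue : Prop :=
  CoreGrossCapture → ScaleJunction → BoundedRoughnessCapture → CensoredGrossCapture

/-- item stmt-FinalStateConjecture-17269 · crux · rank 3 · open · by planner
why it might fail: weak cosmic censorship in the smooth tame vacuum class is open: Christodoulou's instability theorem is BV scalar-field and does not descend (barrier Part 6); wDist-stable naked-singularity formation from admissible vacuum data (beyond the fine-tuned examples of arXiv:2204.09891) is not excluded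
sources: Christodoulou1999, arXiv:2204.09891, arXiv:2402.00062, arXiv:0811.0354, arXiv:1912.08478
[crux] (imported; re-typed successor of WeakCosmicCensorshipMGHD after the statement revision
p126844, re-type T2) TAME weak cosmic censorship in MGHD form: for every connected Hausdorff
second-countable smooth 3-manifold X, tame-Christodoulou-generically in admissibleVacuumData X
(IsTameChristodoulouGeneric … 1: the escaping one-parameter family lives on ONE fixed asymptotically
flat end, is jointly smooth, continuous at c = 0 in the Dafermos–Rodnianski weighted C²₋₁ × C¹₋₂
distance of that end, injective and immersed at c = 0) a maximal vacuum Cauchy development exists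
and every MGHD has complete future null infinity (sojourn form,
Summit.FinalStateConjecture.HasCompleteNullInfinity). This is the first conjunct-structure of the
RE-TYPED summit; NECESSARY (summit ⇒ it by IsTameChristodoulouGeneric.mono — Sketch.lean
tame_of_statement; landed as Theorems/PhaseMixingCaptureCaptureSufficesC2DiagonalReduction
tameCensorship_of_finalStateConjecture); it implies the pre-revision rank-5 item
WeakCosmicCensorshipMGHD (tame ⇒ plain genericity,
IsTameChristodoulouGeneric.isChristodoulouGeneric; landed as
weakCosmicCensorshipMGHD_of_tameCensorship), which stays in the file as a support / imp -/
@[route_item "route-FinalStateConjecture-RootDecompCensoredShadow", crux]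
def TameCensorship : Prop :=
  ∀ (X : Type) [TopologicalSpace X] [ChartedSpace Literature.Geometry.Lorentzian.E3 X] [IsManifold (𝓡 3) ((⊤ : ℕ∞) : WithTop ℕ∞) X] [T2Space X] [SecondCountableTopology X] [ConnectedSpace X], Literature.Geometry.Lorentzian.InitialDataSet.IsTameChristodoulouGeneric (Literature.Geometry.Lorentzian.admissibleVacuumData X) (fun D ↦ (∃ 𝒟 : Literature.Geometry.Lorentzian.VacuumCauchyDevelopment D, 𝒟.IsMaximal) ∧ ∀ 𝒟 : Literature.Geometry.Lorentzian.VacuumCauchyDevelopment D, 𝒟.IsMaximal → Summit.FinalStateConjecture.HasCompleteNullInfinity 𝒟.toCauchyDevelopment) 1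

/-- item stmt-FinalStateConjecture-27103 · crux · rank 4 · open · by planner
why it might fail: tame genericity is not ∧-closed (tree negative isTameChristodoulouGeneric_and_fails): along the censorship-exit line through a naked datum the censored-but-not-unit-captured data may accumulate at the base parameter (a Cantor-like bad set), and no other line need be available
sources: Christodoulou1999, arXiv:0811.0354, Klainerman2025
[crux] the ∧-toll of the censorship door applied to the unit shadow, charged only at NAKED data: for
every admissible Σ and every admissible datum d that is not censored, a tame immersed injective
one-ended family of admissible data through d whose members c ≠ 0 are censored yields a tame
immersed injective one-ended family of admissible data through d whose members c ≠ 0 satisfy Q_Σ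
(possibly another family, another end). Vacuous under the parent; its typed sufficient condition is
TameExitTrim ∧ ShadowGeneralPosition (lens kernel `censorshipShadowJunction_of_generalPosition`,
asides, not items). [deps: TameCensorship, CensoredGrossCapture] [difficulty: L] -/
@[route_item "route-FinalStateConjecture-RootDecompCensoredShadow", crux]
def CensorshipShadowJunction : Prop :=
  ∀ (X : Type) [TopologicalSpace X] [ChartedSpace Literature.Geometry.Lorentzian.E3 X] [IsManifold (𝓡 3) ((⊤ : ℕ∞) : WithTop ℕ∞) X] [T2Space X] [SecondCountableTopology X] [ConnectedSpace X], let Q : Literature.Geometry.Lorentzian.InitialDataSet (𝓡 3) X → Prop := fun D ↦ (∃ 𝒟 : Literature.Geometry.Lorentzian.VacuumCauchyDevelopment D, 𝒟.IsMaximal) ∧ ∀ 𝒟 : Literature.Geometry.Lorentzian.VacuumCauchyDevelopment D, 𝒟.IsMaximal → Summit.FinalStateConjecture.HasCompleteNullInfinity 𝒟.toCauchyDevelopment ∧ ∃ (O : Set 𝒟.carrier) (q : Literature.Geometry.Lorentzian.QuasiFinalStateDecomposition 𝒟.toSpacetime O 2 1), (∀ i, Literature.Geometry.Lorentzian.Kerr.IsSubextremal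 (q.mass i) (q.spin i)) ∧ O = Summit.FinalStateConjecture.exteriorOf 𝒟.toCauchyDevelopment q.charted ∧ Summit.FinalStateConjecture.RaysStayInClosure 𝒟.toCauchyDevelopment O ∧ (∃ R : Fin q.N → ℝ → ℝ, (∀ i, Tendsto (R i) atTop atTop ∧ ∀ τ, max (Literature.Geometry.Lorentzian.Kerr.rPlus (q.mass i) (q.spin i)) 0 + 1 ≤ R i τ) ∧ (∀ i, ∀ᶠ τ in atTop, 𝒟.toSpacetime.truncDeviationCk (q.background i) (q.chart i) 2 (R i τ) τ ≤ 1) ∧ ∀ τ₁ : ℝ, q.τ₀ < τ₁ → O \ q.certifiedLate R τ₁ ⊆ 𝒟.toSpacetime.metric.causalPast 𝒟.toSpacetime.timeOrientation (q.certifiedSlab R τ₁)) ∧ ((∀ i, Summit.FinalStateConjecture.IsOrthochronous (q.motion i).1) ∧ (∀ i (ρ : ℝ), ∀ᶠ τ in atTop, ∀ x ∈ (q.background i).truncTimeSlab ρ τ, 𝒟.toSpacetime.timeOrientation.IsFutureDirected (mfderiv 𝓘(ℝ, Literature.Geometry.Lorentzian.E4) (𝓡 4) (q.chart i) x (((q.motion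 i).1 : Literature.Geometry.Lorentzian.E4 ≃L[ℝ] Literature.Geometry.Lorentzian.E4) (Literature.Geometry.Lorentzian.Kerr.timeVector (q.mass i) (q.spin i) (Literature.Geometry.Lorentzian.poincareInv (q.motion i).1 (q.motion i).2 (x : Literature.Geometry.Lorentzian.E4)))))) ∧ ∀ᶠ τ in atTop, ∀ x ∈ (Literature.Geometry.Lorentzian.Minkowski.backgroundOn q.flatDomain).timeSlab τ, 𝒟.toSpacetime.timeOrientation.IsFutureDirected (mfderiv 𝓘(ℝ, Literature.Geometry.Lorentzian.E4) (𝓡 4) q.flatChart x (Literature.Geometry.Lorentzian.E4.basisVector 0))); let Censored : Literature.Geometry.Lorentzian.InitialDataSet (𝓡 3) X → Prop := fun D ↦ (∃ 𝒟 : Literature.Geometry.Lorentzian.VacuumCauchyDevelopment D, 𝒟.IsMaximal) ∧ ∀ 𝒟 : Literature.Geometry.Lorentzian.VacuumCauchyDevelopment D, 𝒟.IsMaximal → Summit.FinalStateConjecture.HasCompleteNullInfinity 𝒟.toCauchyDevelopment; ∀ d ∈ Literature.Geometry.Lorentzian.admissibleVacuumData X, ¬ Censored d → (∃ (e : Literature.Geometry.Lorentzian.AFEnd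 X) (F : EuclideanSpace ℝ (Fin 1) → Literature.Geometry.Lorentzian.InitialDataSet (𝓡 3) X), Literature.Geometry.Lorentzian.InitialDataSet.IsTameDataFamily e 1 F ∧ Literature.Geometry.Lorentzian.InitialDataSet.IsImmersedAtZero 1 F ∧ F 0 = d ∧ Injective F ∧ (∀ c, F c ∈ Literature.Geometry.Lorentzian.admissibleVacuumData X) ∧ ∀ c ≠ 0, Censored (F c)) → ∃ (e : Literature.Geometry.Lorentzian.AFEnd X) (F : EuclideanSpace ℝ (Fin 1) → Literature.Geometry.Lorentzian.InitialDataSet (𝓡 3) X), Literature.Geometry.Lorentzian.InitialDataSet.IsTameDataFamily e 1 F ∧ Literature.Geometry.Lorentzian.InitialDataSet.IsImmersedAtZero 1 F ∧ F 0 = d ∧ Injective F ∧ (∀ c, F c ∈ Literature.Geometry.Lorentzian.admissibleVacuumData X) ∧ ∀ c ≠ 0, Q (F c)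

/-- item stmt-FinalStateConjecture-25326 · crux · rank 5 · open · by planner
why it might fail: an eternally breathing remnant of Kerr–Schild amplitude below 1 but bounded away from 0 (nonlinear bound state / limit cycle) persisting on a tame-open set would be unit-captured, never captured at small tolerance, and incurable.
sources: arXiv:2104.11857, arXiv:2205.14808, Klainerman2025, arXiv:1606.04014
[crux · gen-2 glued split of WildCell (stmt-24308), lens-6 g2; WEAKER (lens kernel
mesoscopicRingdown_of_summit / _of_capturedRingdown / _of_wildCell); leaf IDEA-NEEDED
(finite-amplitude orbital ⟹ perturbative capture: no eternal remnant of C²-amplitude < 1 survives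
along a generic line; rigidity below unit amplitude) · relieved of third law / censorship / gross
capture · ATTACKABLE sub-rung (conditional ringdown from a-priori orbital control, |a| ≪ M: port of
the decay half of arXiv:2104.11857 / arXiv:2205.14808) · INSTRUMENTABLE] For every Σ, every
admissible P_Σ-exceptional datum that satisfies the unit shadow Q_Σ but is NOT captured at every
tolerance (the born Captured fails) lies on a tame immersed injective one-ended line of admissible
data, based at it, all of whose members c ≠ 0 satisfy P_Σ. -/
@[route_item "route-FinalStateConjecture-RootDecompCensoredShadow", crux]
def MesoscopicRingdown : Prop :=
  ∀ (X : Type) [TopologicalSpace X] [ChartedSpace Literature.Geometry.Lorentzian.E3 X] [IsManifold (𝓡 3) ((⊤ : ℕ∞) : WithTop ℕ∞) X] [T2Space X] [SecondCountableTopology X] [ConnectedSpace X], let P : Literature.Geometry.Lorentzian.InitialDataSet (𝓡 3) X → Prop := fun D ↦ (∃ 𝒟 : Literature.Geometry.Lorentzian.VacuumCauchyDevelopment D, 𝒟.IsMaximal) ∧ ∀ 𝒟 : Literature.Geometry.Lorentzian.VacuumCauchyDevelopment D, 𝒟.IsMaximal → Summit.FinalStateConjecture.HasCompleteNullInfinity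 𝒟.toCauchyDevelopment ∧ ∃ (O : Set 𝒟.carrier) (d : Literature.Geometry.Lorentzian.FinalStateDecomposition 𝒟.toSpacetime O 2), (∀ i, Literature.Geometry.Lorentzian.Kerr.IsSubextremal (d.mass i) (d.spin i)) ∧ O = Summit.FinalStateConjecture.exteriorOf 𝒟.toCauchyDevelopment d.charted ∧ Summit.FinalStateConjecture.RaysStayInClosure 𝒟.toCauchyDevelopment O ∧ Summit.FinalStateConjecture.HasExhaustiveCharts d ∧ Summit.FinalStateConjecture.IsFutureOriented d; let Captured : Literature.Geometry.Lorentzian.InitialDataSet (𝓡 3) X → Prop := fun D ↦ (∃ 𝒟 : Literature.Geometry.Lorentzian.VacuumCauchyDevelopment D, 𝒟.IsMaximal) ∧ ∀ 𝒟 : Literature.Geometry.Lorentzian.VacuumCauchyDevelopment D, 𝒟.IsMaximal → Summit.FinalStateConjecture.HasCompleteNullInfinity 𝒟.toCauchyDevelopment ∧ ∀ δ : ENNReal, 0 < δ → ∃ (O : Set 𝒟.carrier) (q : Literature.Geometry.Lorentzian.QuasiFinalStateDecomposition 𝒟.toSpacetime O 2 δ), (∀ i, Literature.Geometry.Lorentzian.Kerr.IsSubextremal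 (q.mass i) (q.spin i)) ∧ O = Summit.FinalStateConjecture.exteriorOf 𝒟.toCauchyDevelopment q.charted ∧ Summit.FinalStateConjecture.RaysStayInClosure 𝒟.toCauchyDevelopment O ∧ (∃ R : Fin q.N → ℝ → ℝ, (∀ i, Tendsto (R i) atTop atTop ∧ ∀ τ, max (Literature.Geometry.Lorentzian.Kerr.rPlus (q.mass i) (q.spin i)) 0 + 1 ≤ R i τ) ∧ (∀ i, ∀ᶠ τ in atTop, 𝒟.toSpacetime.truncDeviationCk (q.background i) (q.chart i) 2 (R i τ) τ ≤ δ) ∧ ∀ τ₁ : ℝ, q.τ₀ < τ₁ → O \ q.certifiedLate R τ₁ ⊆ 𝒟.toSpacetime.metric.causalPast 𝒟.toSpacetime.timeOrientation (q.certifiedSlab R τ₁)) ∧ ((∀ i, Summit.FinalStateConjecture.IsOrthochronous (q.motion i).1) ∧ (∀ i (ρ : ℝ), ∀ᶠ τ in atTop, ∀ x ∈ (q.background i).truncTimeSlab ρ τ, 𝒟.toSpacetime.timeOrientation.IsFutureDirected (mfderiv 𝓘(ℝ, Literature.Geometry.Lorentzian.E4) (𝓡 4) (q.chart i) x (((q.motion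 i).1 : Literature.Geometry.Lorentzian.E4 ≃L[ℝ] Literature.Geometry.Lorentzian.E4) (Literature.Geometry.Lorentzian.Kerr.timeVector (q.mass i) (q.spin i) (Literature.Geometry.Lorentzian.poincareInv (q.motion i).1 (q.motion i).2 (x : Literature.Geometry.Lorentzian.E4)))))) ∧ ∀ᶠ τ in atTop, ∀ x ∈ (Literature.Geometry.Lorentzian.Minkowski.backgroundOn q.flatDomain).timeSlab τ, 𝒟.toSpacetime.timeOrientation.IsFutureDirected (mfderiv 𝓘(ℝ, Literature.Geometry.Lorentzian.E4) (𝓡 4) q.flatChart x (Literature.Geometry.Lorentzian.E4.basisVector 0))); let Q : Literature.Geometry.Lorentzian.InitialDataSet (𝓡 3) X → Prop := fun D ↦ (∃ 𝒟 : Literature.Geometry.Lorentzian.VacuumCauchyDevelopment D, 𝒟.IsMaximal) ∧ ∀ 𝒟 : Literature.Geometry.Lorentzian.VacuumCauchyDevelopment D, 𝒟.IsMaximal → Summit.FinalStateConjecture.HasCompleteNullInfinity 𝒟.toCauchyDevelopment ∧ ∃ (O : Set 𝒟.carrier) (q : Literature.Geometry.Lorentzian.QuasiFinalStateDecomposition 𝒟.toSpacetime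 O 2 1), (∀ i, Literature.Geometry.Lorentzian.Kerr.IsSubextremal (q.mass i) (q.spin i)) ∧ O = Summit.FinalStateConjecture.exteriorOf 𝒟.toCauchyDevelopment q.charted ∧ Summit.FinalStateConjecture.RaysStayInClosure 𝒟.toCauchyDevelopment O ∧ (∃ R : Fin q.N → ℝ → ℝ, (∀ i, Tendsto (R i) atTop atTop ∧ ∀ τ, max (Literature.Geometry.Lorentzian.Kerr.rPlus (q.mass i) (q.spin i)) 0 + 1 ≤ R i τ) ∧ (∀ i, ∀ᶠ τ in atTop, 𝒟.toSpacetime.truncDeviationCk (q.background i) (q.chart i) 2 (R i τ) τ ≤ 1) ∧ ∀ τ₁ : ℝ, q.τ₀ < τ₁ → O \ q.certifiedLate R τ₁ ⊆ 𝒟.toSpacetime.metric.causalPast 𝒟.toSpacetime.timeOrientation (q.certifiedSlab R τ₁)) ∧ ((∀ i, Summit.FinalStateConjecture.IsOrthochronous (q.motion i).1) ∧ (∀ i (ρ : ℝ), ∀ᶠ τ in atTop, ∀ x ∈ (q.background i).truncTimeSlab ρ τ, 𝒟.toSpacetime.timeOrientation.IsFutureDirected (mfderiv 𝓘(ℝ,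 Literature.Geometry.Lorentzian.E4) (𝓡 4) (q.chart i) x (((q.motion i).1 : Literature.Geometry.Lorentzian.E4 ≃L[ℝ] Literature.Geometry.Lorentzian.E4) (Literature.Geometry.Lorentzian.Kerr.timeVector (q.mass i) (q.spin i) (Literature.Geometry.Lorentzian.poincareInv (q.motion i).1 (q.motion i).2 (x : Literature.Geometry.Lorentzian.E4)))))) ∧ ∀ᶠ τ in atTop, ∀ x ∈ (Literature.Geometry.Lorentzian.Minkowski.backgroundOn q.flatDomain).timeSlab τ, 𝒟.toSpacetime.timeOrientation.IsFutureDirected (mfderiv 𝓘(ℝ, Literature.Geometry.Lorentzian.E4) (𝓡 4) q.flatChart x (Literature.Geometry.Lorentzian.E4.basisVector 0))); ∀ d ∈ Literature.Geometry.Lorentzian.admissibleVacuumData X, ¬ P d → Q d → ¬ Captured d → ∃ (e : Literature.Geometry.Lorentzian.AFEnd X) (F : EuclideanSpace ℝ (Fin 1) → Literature.Geometry.Lorentzian.InitialDataSet (𝓡 3) X), Literature.Geometry.Lorentzian.InitialDataSet.IsTameDataFamily e 1 F ∧ Literature.Geometry.Lorentzian.InitialDataSet.IsImmersedAtZero 1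 F ∧ F 0 = d ∧ Injective F ∧ (∀ c, F c ∈ Literature.Geometry.Lorentzian.admissibleVacuumData X) ∧ ∀ c ≠ 0, P (F c)

/-- item stmt-FinalStateConjecture-25327 · crux · rank 6 · open · by planner
why it might fail: a Cantor-like set of P-bad parameters accumulating at 0 along every Q-exit line through some Q-exceptional datum (laminated ringdown failure inside the unit shadow) gives a Q-exit with no P-exit.
sources: Christodoulou1999, arXiv:gr-qc/0702084, Klainerman2025
[crux (thin) · gen-2 glued split of WildCell (stmt-24308), lens-6 g2; WEAKER (vacuous under S: lens
kernel ringdownJunction_of_summit) · UNDECIDED — stated test: tame general position of 𝓔 ∩ Q along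
coarse-capture lines (is the bad parameter set {c ≠ 0 | ¬P_Σ (F c)} locally finite near 0 on the
lines GenericCoarseCapture produces? yes ⇒ reduces to MesoscopicRingdown by re-basing); the typed
∧-TAX of the relative door (tree negative isTameChristodoulouGeneric_and_fails: tame genericity is
not ∧-closed, so A and B₁′ do not compose without it)] For every Σ, at every admissible
P_Σ-exceptional datum FAILING the unit shadow Q_Σ, a tame immersed injective admissible exit line
into Q_Σ yields a tame immersed injective admissible exit line into P_Σ (possibly another line,
another end). -/
@[route_item "route-FinalStateConjecture-RootDecompCensoredShadow", crux]
def RingdownJunction : Prop :=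
  ∀ (X : Type) [TopologicalSpace X] [ChartedSpace Literature.Geometry.Lorentzian.E3 X] [IsManifold (𝓡 3) ((⊤ : ℕ∞) : WithTop ℕ∞) X] [T2Space X] [SecondCountableTopology X] [ConnectedSpace X], let P : Literature.Geometry.Lorentzian.InitialDataSet (𝓡 3) X → Prop := fun D ↦ (∃ 𝒟 : Literature.Geometry.Lorentzian.VacuumCauchyDevelopment D, 𝒟.IsMaximal) ∧ ∀ 𝒟 : Literature.Geometry.Lorentzian.VacuumCauchyDevelopment D, 𝒟.IsMaximal → Summit.FinalStateConjecture.HasCompleteNullInfinity 𝒟.toCauchyDevelopment ∧ ∃ (O : Set 𝒟.carrier) (d : Literature.Geometry.Lorentzian.FinalStateDecomposition 𝒟.toSpacetime O 2), (∀ i, Literature.Geometry.Lorentzian.Kerr.IsSubextremal (d.mass i) (d.spin i)) ∧ O = Summit.FinalStateConjecture.exteriorOf 𝒟.toCauchyDevelopment d.charted ∧ Summit.FinalStateConjecture.RaysStayInClosure 𝒟.toCauchyDevelopment O ∧ Summit.FinalStateConjecture.HasExhaustiveCharts d ∧ Summit.FinalStateConjecture.IsFutureOriented d; let Q : Literature.Geometry.Lorentzian.InitialDataSet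 (𝓡 3) X → Prop := fun D ↦ (∃ 𝒟 : Literature.Geometry.Lorentzian.VacuumCauchyDevelopment D, 𝒟.IsMaximal) ∧ ∀ 𝒟 : Literature.Geometry.Lorentzian.VacuumCauchyDevelopment D, 𝒟.IsMaximal → Summit.FinalStateConjecture.HasCompleteNullInfinity 𝒟.toCauchyDevelopment ∧ ∃ (O : Set 𝒟.carrier) (q : Literature.Geometry.Lorentzian.QuasiFinalStateDecomposition 𝒟.toSpacetime O 2 1), (∀ i, Literature.Geometry.Lorentzian.Kerr.IsSubextremal (q.mass i) (q.spin i)) ∧ O = Summit.FinalStateConjecture.exteriorOf 𝒟.toCauchyDevelopment q.charted ∧ Summit.FinalStateConjecture.RaysStayInClosure 𝒟.toCauchyDevelopment O ∧ (∃ R : Fin q.N → ℝ → ℝ, (∀ i, Tendsto (R i) atTop atTop ∧ ∀ τ, max (Literature.Geometry.Lorentzian.Kerr.rPlus (q.mass i) (q.spin i)) 0 + 1 ≤ R i τ) ∧ (∀ i, ∀ᶠ τ in atTop, 𝒟.toSpacetime.truncDeviationCk (q.background i) (q.chart i) 2 (R i τ) τ ≤ 1) ∧ ∀ τ₁ : ℝ,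 q.τ₀ < τ₁ → O \ q.certifiedLate R τ₁ ⊆ 𝒟.toSpacetime.metric.causalPast 𝒟.toSpacetime.timeOrientation (q.certifiedSlab R τ₁)) ∧ ((∀ i, Summit.FinalStateConjecture.IsOrthochronous (q.motion i).1) ∧ (∀ i (ρ : ℝ), ∀ᶠ τ in atTop, ∀ x ∈ (q.background i).truncTimeSlab ρ τ, 𝒟.toSpacetime.timeOrientation.IsFutureDirected (mfderiv 𝓘(ℝ, Literature.Geometry.Lorentzian.E4) (𝓡 4) (q.chart i) x (((q.motion i).1 : Literature.Geometry.Lorentzian.E4 ≃L[ℝ] Literature.Geometry.Lorentzian.E4) (Literature.Geometry.Lorentzian.Kerr.timeVector (q.mass i) (q.spin i) (Literature.Geometry.Lorentzian.poincareInv (q.motion i).1 (q.motion i).2 (x : Literature.Geometry.Lorentzian.E4)))))) ∧ ∀ᶠ τ in atTop, ∀ x ∈ (Literature.Geometry.Lorentzian.Minkowski.backgroundOn q.flatDomain).timeSlab τ, 𝒟.toSpacetime.timeOrientation.IsFutureDirected (mfderiv 𝓘(ℝ, Literature.Geometry.Lorentzian.E4) (𝓡 4) q.flatChart x (Literature.Geometry.Lorentzian.E4.basisVector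 0))); ∀ d ∈ Literature.Geometry.Lorentzian.admissibleVacuumData X, ¬ P d → ¬ Q d → (∃ (e : Literature.Geometry.Lorentzian.AFEnd X) (F : EuclideanSpace ℝ (Fin 1) → Literature.Geometry.Lorentzian.InitialDataSet (𝓡 3) X), Literature.Geometry.Lorentzian.InitialDataSet.IsTameDataFamily e 1 F ∧ Literature.Geometry.Lorentzian.InitialDataSet.IsImmersedAtZero 1 F ∧ F 0 = d ∧ Injective F ∧ (∀ c, F c ∈ Literature.Geometry.Lorentzian.admissibleVacuumData X) ∧ ∀ c ≠ 0, Q (F c)) → ∃ (e : Literature.Geometry.Lorentzian.AFEnd X) (F : EuclideanSpace ℝ (Fin 1) → Literature.Geometry.Lorentzian.InitialDataSet (𝓡 3) X), Literature.Geometry.Lorentzian.InitialDataSet.IsTameDataFamily e 1 F ∧ Literature.Geometry.Lorentzian.InitialDataSet.IsImmersedAtZero 1 F ∧ F 0 = d ∧ Injective F ∧ (∀ c, F c ∈ Literature.Geometry.Lorentzian.admissibleVacuumData X) ∧ ∀ c ≠ 0, P (F c)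

/-- item stmt-FinalStateConjecture-24307 · crux · rank 7 · open · by planner
why it might fail: data whose MGHDs converge to an EXACTLY EXTREMAL Kerr exterior might fill a tame-open set (third law false in the charged model, arXiv:2211.15742; extremal formation conjectured critical = positive codimension, arXiv:2402.10190, unproved in vacuum).
sources: Klainerman2025, arXiv:2211.15742, arXiv:2402.10190, KlainermanSzeftel2020, Hintz2026
[crux] PIECE A — PerturbativeCell [WEAKER — critic CLEARED 2026-08-30T01:32:21Z: «S∖WildCell is
NAMED and non-empty: concrete member = the exact EXTREMAL Kerr datum … hard members = dynamically
forming exactly-extremal holes»; leaves ThirdLawCell WEAKER·IDEA-NEEDED, Stitching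
UNDECIDED·ATTACKABLE (aside items below); BARRIER AretakisInstability on every uniform-basin road].
For every Σ and every admissible P_Σ-exceptional datum d that IS captured (an MGHD exists; every
MGHD has complete 𝓘⁺ and, for every δ > 0, a sub-extremal δ-quasi final state decomposition with O =
exteriorOf q.charted, rays in closure O, honest-radii quasi-exhaustive future-oriented charts),
there are ONE asymptotically flat end e and a tame (IsTameDataFamily e 1), immersed-at-0, injective
one-parameter family F of admissible data with F 0 = d all of whose members c ≠ 0 satisfy P_Σ.
Content: the generic third law (extremal parameter limits), gauge stitching of δ-indexed chart
systems, label convergence in the closed range. [difficulty: open-problem] -/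
@[route_item "route-FinalStateConjecture-RootDecompCensoredShadow", crux]
def PerturbativeCell : Prop :=
  ∀ (X : Type) [TopologicalSpace X] [ChartedSpace Literature.Geometry.Lorentzian.E3 X] [IsManifold (𝓡 3) ((⊤ : ℕ∞) : WithTop ℕ∞) X] [T2Space X] [SecondCountableTopology X] [ConnectedSpace X], let P : Literature.Geometry.Lorentzian.InitialDataSet (𝓡 3) X → Prop := fun D ↦ (∃ 𝒟 : Literature.Geometry.Lorentzian.VacuumCauchyDevelopment D, 𝒟.IsMaximal) ∧ ∀ 𝒟 : Literature.Geometry.Lorentzian.VacuumCauchyDevelopment D, 𝒟.IsMaximal → Summit.FinalStateConjecture.HasCompleteNullInfinity 𝒟.toCauchyDevelopment ∧ ∃ (O : Set 𝒟.carrier) (d : Literature.Geometry.Lorentzian.FinalStateDecomposition 𝒟.toSpacetime O 2), (∀ i, Literature.Geometry.Lorentzian.Kerr.IsSubextremal (d.mass i) (d.spin i)) ∧ O = Summit.FinalStateConjecture.exteriorOf 𝒟.toCauchyDevelopment d.charted ∧ Summit.FinalStateConjecture.RaysStayInClosure 𝒟.toCauchyDevelopment O ∧ Summit.FinalStateConjecture.HasExhaustiveCharts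 d ∧ Summit.FinalStateConjecture.IsFutureOriented d; let Captured : Literature.Geometry.Lorentzian.InitialDataSet (𝓡 3) X → Prop := fun D ↦ (∃ 𝒟 : Literature.Geometry.Lorentzian.VacuumCauchyDevelopment D, 𝒟.IsMaximal) ∧ ∀ 𝒟 : Literature.Geometry.Lorentzian.VacuumCauchyDevelopment D, 𝒟.IsMaximal → Summit.FinalStateConjecture.HasCompleteNullInfinity 𝒟.toCauchyDevelopment ∧ ∀ δ : ENNReal, 0 < δ → ∃ (O : Set 𝒟.carrier) (q : Literature.Geometry.Lorentzian.QuasiFinalStateDecomposition 𝒟.toSpacetime O 2 δ), (∀ i, Literature.Geometry.Lorentzian.Kerr.IsSubextremal (q.mass i) (q.spin i)) ∧ O = Summit.FinalStateConjecture.exteriorOf 𝒟.toCauchyDevelopment q.charted ∧ Summit.FinalStateConjecture.RaysStayInClosure 𝒟.toCauchyDevelopment O ∧ (∃ R : Fin q.N → ℝ → ℝ, (∀ i, Tendsto (R i) atTop atTop ∧ ∀ τ, max (Literature.Geometry.Lorentzian.Kerr.rPlus (q.mass i) (q.spin i)) 0 + 1 ≤ R i τ) ∧ (∀ i, ∀ᶠ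 τ in atTop, 𝒟.toSpacetime.truncDeviationCk (q.background i) (q.chart i) 2 (R i τ) τ ≤ δ) ∧ ∀ τ₁ : ℝ, q.τ₀ < τ₁ → O \ q.certifiedLate R τ₁ ⊆ 𝒟.toSpacetime.metric.causalPast 𝒟.toSpacetime.timeOrientation (q.certifiedSlab R τ₁)) ∧ ((∀ i, Summit.FinalStateConjecture.IsOrthochronous (q.motion i).1) ∧ (∀ i (ρ : ℝ), ∀ᶠ τ in atTop, ∀ x ∈ (q.background i).truncTimeSlab ρ τ, 𝒟.toSpacetime.timeOrientation.IsFutureDirected (mfderiv 𝓘(ℝ, Literature.Geometry.Lorentzian.E4) (𝓡 4) (q.chart i) x (((q.motion i).1 : Literature.Geometry.Lorentzian.E4 ≃L[ℝ] Literature.Geometry.Lorentzian.E4) (Literature.Geometry.Lorentzian.Kerr.timeVector (q.mass i) (q.spin i) (Literature.Geometry.Lorentzian.poincareInv (q.motion i).1 (q.motion i).2 (x : Literature.Geometry.Lorentzian.E4)))))) ∧ ∀ᶠ τ in atTop, ∀ x ∈ (Literature.Geometry.Lorentzian.Minkowski.backgroundOn q.flatDomain).timeSlab τ, 𝒟.toSpacetime.timeOrientation.IsFutureDirected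 (mfderiv 𝓘(ℝ, Literature.Geometry.Lorentzian.E4) (𝓡 4) q.flatChart x (Literature.Geometry.Lorentzian.E4.basisVector 0))); ∀ d ∈ Literature.Geometry.Lorentzian.admissibleVacuumData X, ¬ P d → Captured d → ∃ (e : Literature.Geometry.Lorentzian.AFEnd X) (F : EuclideanSpace ℝ (Fin 1) → Literature.Geometry.Lorentzian.InitialDataSet (𝓡 3) X), Literature.Geometry.Lorentzian.InitialDataSet.IsTameDataFamily e 1 F ∧ Literature.Geometry.Lorentzian.InitialDataSet.IsImmersedAtZero 1 F ∧ F 0 = d ∧ Injective F ∧ (∀ c, F c ∈ Literature.Geometry.Lorentzian.admissibleVacuumData X) ∧ ∀ c ≠ 0, P (F c)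

/-- item stmt-FinalStateConjecture-27104 · assembly · rank 1 · open · by planner
sources: Christodoulou1999
[assembly] TameCensorship → CensoredGrossCapture → CensorshipShadowJunction → MesoscopicRingdown →
RingdownJunction → PerturbativeCell → FinalStateConjecture -/
@[route_item "route-FinalStateConjecture-RootDecompCensoredShadow"]
def Assembly : Prop :=
  TameCensorship → CensoredGrossCapture → CensorshipShadowJunction → MesoscopicRingdown → RingdownJunction → PerturbativeCell → FinalStateConjecture

/-! D-0027 §2.1 — DECIDING THEOREM (planner-authored via `route open/edit --closes-file`; by planner-decomp-fsc-writer-1-g0-0 2026-08-30T03:53:43Z):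
its hypotheses are this route's items and its conclusion the sub-problem Statement (glue_lint), and it elaborates with this file. -/

@[closes "route-FinalStateConjecture-RootDecompCensoredShadow"] theorem closes (h₁ : TameCensorship) (h₂ : CensoredGrossCapture) (h₃ : CensorshipShadowJunction)
    (hM : MesoscopicRingdown) (hJ : RingdownJunction) (hPC : PerturbativeCell) : FinalStateConjecture := by
  intro X _ _ _ _ _ _ d hd
  suffices h : ∃ (e : Literature.Geometry.Lorentzian.AFEnd X) (F : EuclideanSpace ℝ (Fin 1) → Literature.Geometry.Lorentzian.InitialDataSet (𝓡 3) X), Literature.Geometry.Lorentzian.InitialDataSet.IsTameDataFamily e 1 F ∧ Literature.Geometry.Lorentzian.InitialDataSet.IsImmersedAtZero 1 F ∧ F 0 = d ∧ Injective F ∧ (∀ c, F c ∈ Literature.Geometry.Lorentzian.admissibleVacuumData X) ∧ ∀ c ≠ 0, ((∃ 𝒟 : Literature.Geometry.Lorentzian.VacuumCauchyDevelopment (F c), 𝒟.IsMaximal) ∧ ∀ 𝒟 : Literature.Geometry.Lorentzian.VacuumCauchyDevelopment (F c), 𝒟.IsMaximal → Summit.FinalStateConjecture.HasCompleteNullInfinity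 𝒟.toCauchyDevelopment ∧ ∃ (O : Set 𝒟.carrier) (d : Literature.Geometry.Lorentzian.FinalStateDecomposition 𝒟.toSpacetime O 2), (∀ i, Literature.Geometry.Lorentzian.Kerr.IsSubextremal (d.mass i) (d.spin i)) ∧ O = Summit.FinalStateConjecture.exteriorOf 𝒟.toCauchyDevelopment d.charted ∧ Summit.FinalStateConjecture.RaysStayInClosure 𝒟.toCauchyDevelopment O ∧ Summit.FinalStateConjecture.HasExhaustiveCharts d ∧ Summit.FinalStateConjecture.IsFutureOriented d) by
    obtain ⟨e, F, h1, h2, h3, h4, h5, h6⟩ := h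
    exact ⟨e, F, h1, h2, h3, h4, h5, fun c hc hmem ↦ hmem.2 (h6 c hc)⟩
  -- excluded middle on «d is captured»: PerturbativeCell cures the captured case; the five finer children the wild case
  by_contra hne
  refine hne (hPC X d hd.1 hd.2 (Classical.not_not.mp fun hCap ↦ hne ?_))
  -- wild case: MesoscopicRingdown cures d if the unit shadow Q holds at d …
  have key := fun hQ ↦ hne (hM X d hd.1 hd.2 hQ hCap)
  -- … else a Q-exit through d — CensoredGrossCapture if d is censored; if d is naked, TameCensorship's censorship
  -- exit handed to CensorshipShadowJunction — is turned into a P-exit by RingdownJunction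
  refine hJ X d hd.1 hd.2 key ((em _).elim (h₂ X d hd.1 key) fun hC ↦ ?_)
  obtain ⟨e, F, g1, g2, g3, g4, g5, g6⟩ := h₁ X d ⟨hd.1, hC⟩
  exact h₃ X d hd.1 hC ⟨e, F, g1, g2, g3, g4, g5, fun c hc ↦ by
    by_contra hn
    exact g6 c hc ⟨g5 c, hn⟩⟩

end Summit.FinalStateConjecture.FinalStateConjecture.Theses.RootDecompCensoredShadow
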